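import Literature.MathematicalPhysics.QuantumFieldTheory.SUNBakryEmeryPoincare
import HarnessLib

/-!
# The Bakry–Émery Poincaré inequality on `SU(N)` for a general smooth potential under a curvature bound

`SUNBakryEmeryPoincare.lean` proves the Poincaré inequality for the one-link Gibbs measures
`e^{S} dσ` on `SU(N)` with the LINEAR potential `S(Q) = c Re tr(Q B)` (Shen–Zhu–Zhu, CMP 400 (2023),
Thm. 4.2 / Cor. 4.4 for `Λ = {e}`), by an elementary Bakry–Émery argument (Bochner formula in the
Parseval frame of `𝔰𝔲(N)`, integration by parts on the Haar measure, density of polynomials instead of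
elliptic regularity).  Inspection of that proof shows that the shape of the potential enters at ONE
place only: the pointwise curvature–dimension inequality `Γ₂(u) ≥ K Γ(u,u)` on `SU(N)`
(`SUNBakryEmery.Gam2_potential_ge`).  This file records the general statement, which is the
`SU(N)`-instance of the classical Bakry–Émery theorem (Bakry–Émery 1985; Bakry–Gentil–Ledoux,
Prop. 4.8.1: `CD(ρ, ∞) ⇒` Poincaré with constant `1/ρ`):

* `SUNBakryEmery.poincare_of_curvature` : for `N ≠ 0`, a smooth ambient potential
  `S : M_N(ℂ) → ℝ`, a constant `K > 0` with `K Γ(u,u)(g) ≤ Γ₂^S(u)(g)` for every smooth `u` and every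
  `g ∈ SU(N)`, and every smooth `u`,
  `K ∫ e^S (u − m)² dσ ≤ ∫ e^S Γ(u,u) dσ`, `m` the `e^S σ`-mean of `u` (`σ` the Haar probability of `SU(N)`).

The proof is the proof of `SUNBakryEmery.poincare_pot` with `pot c B` replaced by `S` and
`N/2 − |c| ‖B‖_op` by `K`: integrated curvature–dimension inequality
(`integral_exp_mul_Gam_le_of_curvature`), Poincaré from approximate solvability of the Poisson equation
(`poincare_of_approx_of_curvature`), the projection argument with the Schrödinger weight
`W = ¼Γ(S,S) + ½ΔS` (`schWOf`, `exists_proj_seq_schWOf`), THM(IV) for the tilted measure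
(`ae_eq_groundState_of_orthogonal_schWOf`) and the double-orthogonal-complement argument
(`poincare_of_thm4_of_curvature`).  Polynomiality of `S` is NOT needed (only of the test functions):
`W` enters through its sup over the compact group.

Consumer: the one-link conditional laws of the Eguchi–Kawai single-site model, whose potential
`Q ↦ N b Σ Re tr(Q A Qᴴ B)` is quadratic (not a linear `pot c B`).

Nothing here concerns the Yang–Mills mass gap.

## References

* D. Bakry, M. Émery, *Diffusions hypercontractives*, Sém. Probab. XIX, LNM 1123 (1985) 177–206.
* D. Bakry, I. Gentil, M. Ledoux, *Analysis and Geometry of Markov Diffusion Operators*,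
  Grundlehren 348 (2014), Prop. 4.8.1.
* H. Shen, R. Zhu, X. Zhu, CMP 400 (2023) 805–851, arXiv:2204.12737, Thm. 4.2, (4.5)–(4.7), Cor. 4.4.
-/

noncomputable section

open scoped Matrix ComplexConjugate BigOperators

namespace Literature.MathematicalPhysics.QuantumFieldTheory

namespace SUNBakryEmery

open scoped Matrix.Norms.Frobenius ContDiff Topology InnerProductSpace
open Matrix Complex Finset MeasureTheory Filter

variable {N : ℕ}

/-! ### The integrated curvature–dimension inequality and the duality argument -/

/-- `Γ₂^S(u)` is smooth for smooth `S`, `u`. [folklore] -/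
private theorem contDiff_Gam2 {S u : Matrix (Fin N) (Fin N) ℂ → ℝ} (hS : ContDiff ℝ ∞ S) (hu : ContDiff ℝ ∞ u) :
    ContDiff ℝ ∞ (Gam2 S u) := by
  have : Gam2 S u = fun Q => (1 / 2) * genL S (Gam u u) Q - Gam u (genL S u) Q := rfl
  rw [this]
  exact (contDiff_const.mul (contDiff_genL hS (contDiff_Gam hu hu))).sub (contDiff_Gam hu (contDiff_genL hS hu))

/-- **Integrated curvature–dimension inequality**: if `K Γ(u,u) ≤ Γ₂^S(u)` pointwise on `SU(N)` for all
smooth `u`, then `K ∫ Γ(u,u) e^{S} dσ ≤ ∫ (L_S u)² e^{S} dσ` (Bakry–Émery's `CD(K,∞)` integrated against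
the invariant measure; Shen–Zhu–Zhu (4.7) for one link). [cite: BakryGentilLedoux2014, Prop. 4.8.1] -/
theorem integral_exp_mul_Gam_le_of_curvature (hN : N ≠ 0) {S : Matrix (Fin N) (Fin N) ℂ → ℝ}
    (hS : ContDiff ℝ ∞ S) (K : ℝ)
    (hCD : ∀ u : Matrix (Fin N) (Fin N) ℂ → ℝ, ContDiff ℝ ∞ u → ∀ g : SUN N,
      K * Gam u u (g : Matrix (Fin N) (Fin N) ℂ) ≤ Gam2 S u (g : Matrix (Fin N) (Fin N) ℂ))
    {u : Matrix (Fin N) (Fin N) ℂ → ℝ} (hu : ContDiff ℝ ∞ u) :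
    K * ∫ g : SUN N, Real.exp (S g) * Gam u u g ∂(haarProbability (SUN N)) ≤
      ∫ g : SUN N, Real.exp (S g) * genL S u g ^ 2 ∂(haarProbability (SUN N)) := by
  rw [integral_exp_mul_genL_sq hN hS hu, ← integral_const_mul]
  refine integral_mono ?_ ?_ fun g => ?_
  · exact (integrable_of_continuous_SUN (continuous_restrict (hS.exp.mul (contDiff_Gam hu hu))) _).const_mul _
  · exact integrable_of_continuous_SUN (continuous_restrict (hS.exp.mul (contDiff_Gam2 hS hu))) _
  · have h := hCD u hu g
    have hpos := Real.exp_pos (S (g : Matrix (Fin N) (Fin N) ℂ))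
    calc K * (Real.exp (S g) * Gam u u g) = Real.exp (S g) * (K * Gam u u g) := by ring
      _ ≤ Real.exp (S g) * Gam2 S u g := mul_le_mul_of_nonneg_left h hpos.le

/-- **Poincaré inequality from approximate solvability of the Poisson equation** for a general smooth
potential `S` with curvature constant `K > 0`: if smooth `v_k` satisfy `∫ e^S (L_S v_k − (u − m))² dσ → 0`,
then `K ∫ e^S (u − m)² dσ ≤ ∫ e^S Γ(u,u) dσ` (duality, Cauchy–Schwarz and the integrated Bochner
inequality; verbatim the argument of `poincare_of_approx`). [cite: BakryGentilLedoux2014, Prop. 4.8.1] -/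
theorem poincare_of_approx_of_curvature (hN : N ≠ 0) {S : Matrix (Fin N) (Fin N) ℂ → ℝ}
    (hS : ContDiff ℝ ∞ S) {K : ℝ} (hK : 0 < K)
    (hCD : ∀ u : Matrix (Fin N) (Fin N) ℂ → ℝ, ContDiff ℝ ∞ u → ∀ g : SUN N,
      K * Gam u u (g : Matrix (Fin N) (Fin N) ℂ) ≤ Gam2 S u (g : Matrix (Fin N) (Fin N) ℂ))
    {u : Matrix (Fin N) (Fin N) ℂ → ℝ} (hu : ContDiff ℝ ∞ u) (m : ℝ)
    (v : ℕ → Matrix (Fin N) (Fin N) ℂ → ℝ) (hv : ∀ k, ContDiff ℝ ∞ (v k))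
    (hconv : Tendsto (fun k => ∫ g : SUN N, Real.exp (S g) *
      (genL S (v k) g - (u g - m)) ^ 2 ∂(haarProbability (SUN N))) atTop (𝓝 0)) :
    K * ∫ g : SUN N, Real.exp (S g) * (u g - m) ^ 2 ∂(haarProbability (SUN N)) ≤
      ∫ g : SUN N, Real.exp (S g) * Gam u u g ∂(haarProbability (SUN N)) := by
  set σ := haarProbability (SUN N) with hσ
  have hSc : Continuous fun g : SUN N => S g := continuous_restrict hS
  have hu0 : ContDiff ℝ ∞ (fun Q => u Q - m) := hu.sub contDiff_const
  -- the quantities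
  set A : ℝ := ∫ g : SUN N, Real.exp (S g) * (u g - m) ^ 2 ∂σ with hAdef
  set G : ℝ := ∫ g : SUN N, Real.exp (S g) * Gam u u g ∂σ with hGdef
  set e : ℕ → ℝ := fun k => ∫ g : SUN N, Real.exp (S g) * (genL S (v k) g - (u g - m)) ^ 2 ∂σ with hedef
  have hA0 : 0 ≤ A := integral_nonneg fun g => mul_nonneg (Real.exp_pos _).le (sq_nonneg _)
  have hG0 : 0 ≤ G := integral_nonneg fun g => mul_nonneg (Real.exp_pos _).le (Gam_self_nonneg _ _)
  have he0 : ∀ k, 0 ≤ e k := fun k => integral_nonneg fun g => mul_nonneg (Real.exp_pos _).le (sq_nonneg _)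
  change K * A ≤ G
  -- the key estimate for each `k`
  have hkey : ∀ k, A ≤ Real.sqrt (G / K) * (Real.sqrt A + Real.sqrt (e k)) + Real.sqrt A * Real.sqrt (e k) := by
    intro k
    have hvk := hv k
    have hLc : Continuous fun g : SUN N => genL S (v k) g := continuous_restrict (contDiff_genL hS hvk)
    have huc : Continuous fun g : SUN N => u g - m := continuous_restrict hu0
    have hwc : Continuous fun g : SUN N => Real.exp (S g) := Real.continuous_exp.comp hSc
    -- Step 1: `A = ∫ w (u-m) L v_k + ∫ w (u-m) ((u-m) - L v_k)`
    have i1 : Integrable (fun g : SUN N => Real.exp (S g) * ((u g - m) * genL S (v k) g)) σ :=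
      integrable_of_continuous_SUN (hwc.mul (huc.mul hLc)) σ
    have i2 : Integrable (fun g : SUN N => Real.exp (S g) * ((u g - m) * ((u g - m) - genL S (v k) g))) σ :=
      integrable_of_continuous_SUN (hwc.mul (huc.mul (huc.sub hLc))) σ
    have hsplit : A = ∫ g : SUN N, Real.exp (S g) * ((u g - m) * genL S (v k) g) ∂σ +
        ∫ g : SUN N, Real.exp (S g) * ((u g - m) * ((u g - m) - genL S (v k) g)) ∂σ := by
      rw [← integral_add i1 i2]
      refine integral_congr_ae (ae_of_all _ fun g => ?_)
      ring
    -- Step 2: `∫ w (u-m) L v_k = -∫ w Γ(u, v_k)`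
    have hstep2 : ∫ g : SUN N, Real.exp (S g) * ((u g - m) * genL S (v k) g) ∂σ =
        -∫ g : SUN N, Real.exp (S g) * Gam u (v k) g ∂σ := by
      have h1 := integral_mul_exp_mul_genL hN hS hu hvk
      have h2 := integral_exp_mul_genL_eq_zero hN hS hvk
      have : ∫ g : SUN N, Real.exp (S g) * ((u g - m) * genL S (v k) g) ∂σ =
          ∫ g : SUN N, u g * (Real.exp (S g) * genL S (v k) g) ∂σ -
            m * ∫ g : SUN N, Real.exp (S g) * genL S (v k) g ∂σ := by
        have i3 : Integrable (fun g : SUN N => u g * (Real.exp (S g) * genL S (v k) g)) σ :=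
          integrable_of_continuous_SUN ((continuous_restrict hu).mul (hwc.mul hLc)) σ
        have i4 : Integrable (fun g : SUN N => m * (Real.exp (S g) * genL S (v k) g)) σ :=
          (integrable_of_continuous_SUN (hwc.mul hLc) σ).const_mul m
        rw [← integral_const_mul, ← integral_sub i3 i4]
        refine integral_congr_ae (ae_of_all _ fun g => ?_)
        ring
      rw [this, h1, h2, mul_zero, sub_zero]
    -- Steps 3 & 4
    have hstep3 := abs_integral_exp_mul_Gam_le hS hu hvk σ
    have hstep4 : ∫ g : SUN N, Real.exp (S g) * Gam (v k) (v k) g ∂σ ≤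
        (1 / K) * ∫ g : SUN N, Real.exp (S g) * genL S (v k) g ^ 2 ∂σ := by
      have h := integral_exp_mul_Gam_le_of_curvature hN hS K hCD hvk
      rw [one_div, ← div_eq_inv_mul, le_div_iff₀ hK, mul_comm]
      exact h
    -- Step 5
    have hstep5 : |∫ g : SUN N, Real.exp (S g) * ((u g - m) * ((u g - m) - genL S (v k) g)) ∂σ| ≤
        Real.sqrt A * Real.sqrt (e k) := by
      have h := abs_integral_exp_mul_mul_le (f := fun g : SUN N => u g - m)
        (g := fun g : SUN N => (u g - m) - genL S (v k) g) hSc huc (huc.sub hLc) σ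
      have : ∫ g : SUN N, Real.exp (S g) * ((u g - m) - genL S (v k) g) ^ 2 ∂σ = e k := by
        simp only [hedef]
        refine integral_congr_ae (ae_of_all _ fun g => ?_)
        ring
      rwa [this] at h
    -- Step 6
    have hstep6 : ∫ g : SUN N, Real.exp (S g) * genL S (v k) g ^ 2 ∂σ ≤ (Real.sqrt A + Real.sqrt (e k)) ^ 2 := by
      have hcs := abs_integral_exp_mul_mul_le (f := fun g : SUN N => u g - m)
        (g := fun g : SUN N => genL S (v k) g - (u g - m)) hSc huc (hLc.sub huc) σ
      have hek : ∫ g : SUN N, Real.exp (S g) * (genL S (v k) g - (u g - m)) ^ 2 ∂σ = e k := rfl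
      rw [hek] at hcs
      have hexp : ∫ g : SUN N, Real.exp (S g) * genL S (v k) g ^ 2 ∂σ =
          A + 2 * ∫ g : SUN N, Real.exp (S g) * ((u g - m) * (genL S (v k) g - (u g - m))) ∂σ +
            ∫ g : SUN N, Real.exp (S g) * (genL S (v k) g - (u g - m)) ^ 2 ∂σ := by
        have j1 : Integrable (fun g : SUN N => Real.exp (S g) * (u g - m) ^ 2) σ :=
          integrable_of_continuous_SUN (hwc.mul (huc.pow 2)) σ
        have j2 : Integrable (fun g : SUN N => 2 * (Real.exp (S g) * ((u g - m) * (genL S (v k) g - (u g - m))))) σ :=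
          (integrable_of_continuous_SUN (hwc.mul (huc.mul (hLc.sub huc))) σ).const_mul 2
        have j12 : Integrable (fun g : SUN N => Real.exp (S g) * (u g - m) ^ 2 +
            2 * (Real.exp (S g) * ((u g - m) * (genL S (v k) g - (u g - m))))) σ := j1.add j2
        have j3 : Integrable (fun g : SUN N => Real.exp (S g) * (genL S (v k) g - (u g - m)) ^ 2) σ :=
          integrable_of_continuous_SUN (hwc.mul ((hLc.sub huc).pow 2)) σ
        rw [← integral_const_mul, hAdef, ← integral_add j1 j2, ← integral_add j12 j3]
        refine integral_congr_ae (ae_of_all _ fun g => ?_)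
        ring
      have hek : ∫ g : SUN N, Real.exp (S g) * (genL S (v k) g - (u g - m)) ^ 2 ∂σ = e k := rfl
      rw [hexp, hek, add_sq, Real.sq_sqrt hA0, Real.sq_sqrt (he0 k)]
      have := (abs_le.1 hcs).2
      nlinarith
    -- combine
    have h34 : |∫ g : SUN N, Real.exp (S g) * Gam u (v k) g ∂σ| ≤
        Real.sqrt G * Real.sqrt ((1 / K) * (Real.sqrt A + Real.sqrt (e k)) ^ 2) := by
      refine hstep3.trans (mul_le_mul_of_nonneg_left (Real.sqrt_le_sqrt (hstep4.trans ?_)) (Real.sqrt_nonneg _))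
      exact mul_le_mul_of_nonneg_left hstep6 (by positivity)
    have hsqrt : Real.sqrt ((1 / K) * (Real.sqrt A + Real.sqrt (e k)) ^ 2) =
        Real.sqrt (1 / K) * (Real.sqrt A + Real.sqrt (e k)) := by
      rw [Real.sqrt_mul (by positivity), Real.sqrt_sq (by positivity)]
    rw [hsqrt] at h34
    have hGK : Real.sqrt G * (Real.sqrt (1 / K) * (Real.sqrt A + Real.sqrt (e k))) =
        Real.sqrt (G / K) * (Real.sqrt A + Real.sqrt (e k)) := by
      rw [← mul_assoc, ← Real.sqrt_mul hG0, ← div_eq_mul_one_div]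
    rw [hGK] at h34
    have h2' := (abs_le.1 h34).1
    have h5' := (abs_le.1 hstep5).2
    linarith [hsplit, hstep2, h2', h5']
  -- pass to the limit `e k → 0`
  have hlim : Tendsto (fun k => Real.sqrt (G / K) * (Real.sqrt A + Real.sqrt (e k)) + Real.sqrt A * Real.sqrt (e k))
      atTop (𝓝 (Real.sqrt (G / K) * (Real.sqrt A + Real.sqrt 0) + Real.sqrt A * Real.sqrt 0)) := by
    have hse : Tendsto (fun k => Real.sqrt (e k)) atTop (𝓝 (Real.sqrt 0)) :=
      (Real.continuous_sqrt.tendsto 0).comp hconv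
    exact ((tendsto_const_nhds.add hse).const_mul _).add (hse.const_mul _)
  rw [Real.sqrt_zero, add_zero, mul_zero, add_zero] at hlim
  have hAle : A ≤ Real.sqrt (G / K) * Real.sqrt A := ge_of_tendsto' hlim hkey
  by_cases hA1 : Real.sqrt A = 0
  · have : A = 0 := by rwa [Real.sqrt_eq_zero hA0] at hA1
    rw [this, mul_zero]; exact hG0
  · have hsApos : 0 < Real.sqrt A := lt_of_le_of_ne (Real.sqrt_nonneg A) (Ne.symm hA1)
    have h1 : Real.sqrt A * Real.sqrt A ≤ Real.sqrt (G / K) * Real.sqrt A := by rwa [Real.mul_self_sqrt hA0]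
    have h2 : Real.sqrt A ≤ Real.sqrt (G / K) := le_of_mul_le_mul_right h1 hsApos
    have h3 : A ≤ G / K := by
      calc A = Real.sqrt A ^ 2 := (Real.sq_sqrt hA0).symm
        _ ≤ Real.sqrt (G / K) ^ 2 := pow_le_pow_left₀ (Real.sqrt_nonneg A) h2 2
        _ = G / K := Real.sq_sqrt (div_nonneg hG0 hK.le)
    rwa [le_div_iff₀ hK, mul_comm] at h3

/-! ### The Schrödinger weight of a general potential and the projection argument -/

/-- The **Schrödinger weight** `W_S = ¼ Γ(S,S) + ½ ΔS` of the ground-state transform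
`e^{S/2} L_S e^{-S/2} = Δ − W_S`, for a general potential `S`. [folklore] -/
def schWOf (S : Matrix (Fin N) (Fin N) ℂ → ℝ) : Matrix (Fin N) (Fin N) ℂ → ℝ :=
  fun Q => (1 / 4) * Gam S S Q + (1 / 2) * Lap S Q

/-- `W_S` is smooth for smooth `S`. [folklore] -/
private theorem contDiff_schWOf {S : Matrix (Fin N) (Fin N) ℂ → ℝ} (hS : ContDiff ℝ ∞ S) : ContDiff ℝ ∞ (schWOf S) :=
  (contDiff_const.mul (contDiff_Gam hS hS)).add (contDiff_const.mul (contDiff_Lap hS))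

/-- **The projection argument** for a general smooth weight `S`: if `w ∈ L²(σ)` is orthogonal to
`(Δ − W_S)p` for every polynomial `p`, then the projections `p_n` of `w` onto `V_n` satisfy `p_n → w` in
`L²`, `‖p_n‖ ≤ ‖w‖`, and `∫ Γ(p_n,p_n) dσ = −∫ w W_S p_n dσ` (only `Δ𝒫_n ⊆ 𝒫_n` and continuity of `W_S`
are used). [folklore] -/
private theorem exists_proj_seq_schWOf (hN : N ≠ 0) {S : Matrix (Fin N) (Fin N) ℂ → ℝ} (hS : ContDiff ℝ ∞ S)
    (w : Lp ℝ 2 (haarSU N))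
    (hw : ∀ n, ∀ p ∈ polySpace N n,
      ∫ g : SUN N, w g * (Lap p g - schWOf S g * p g) ∂(haarSU N) = 0) :
    ∃ p : ℕ → Matrix (Fin N) (Fin N) ℂ → ℝ, (∀ n, p n ∈ polySpace N n) ∧
      Tendsto (fun n => ∫ g : SUN N, (p n g - w g) ^ 2 ∂(haarSU N)) atTop (𝓝 0) ∧
      (∀ n, ∫ g : SUN N, p n g ^ 2 ∂(haarSU N) ≤ ‖w‖ ^ 2) ∧
      ∀ n, ∫ g : SUN N, Gam (p n) (p n) g ∂(haarSU N) =
        -∫ g : SUN N, w g * (schWOf S g * p n g) ∂(haarSU N) := by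
  set wn : ℕ → Lp ℝ 2 (haarSU N) := fun n => (VPoly N n).starProjection w with hwn
  have hwn_mem : ∀ n, wn n ∈ VPoly N n := fun n => by
    rw [hwn]
    simp only [Submodule.starProjection_apply]
    exact Submodule.coe_mem _
  have hq : ∀ n, ∃ q : polySpace N n, TPoly n q = wn n := fun n => LinearMap.mem_range.1 (hwn_mem n)
  choose q hq using hq
  refine ⟨fun n => (q n).1, fun n => (q n).2, ?_, ?_, ?_⟩
  · have ht : Tendsto (fun n => wn n) atTop (𝓝 w) :=
      Submodule.starProjection_tendsto_self (VPoly N) monotone_VPoly w top_le_closure_iSup_VPoly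
    have ht' : Tendsto (fun n => ‖wn n - w‖ ^ 2) atTop (𝓝 0) := by
      have h1 : Tendsto (fun n => ‖wn n - w‖) atTop (𝓝 0) := tendsto_iff_norm_sub_tendsto_zero.1 ht
      simpa using h1.pow 2
    refine ht'.congr fun n => ?_
    rw [← hq n, TPoly_apply, norm_toL2_sub_sq]
    rfl
  · intro n
    have h1 : ‖wn n‖ ≤ ‖w‖ := Submodule.norm_starProjection_apply_le (VPoly N n) w
    have h2 : ∫ g : SUN N, (q n).1 g ^ 2 ∂(haarSU N) = ‖wn n‖ ^ 2 := by
      rw [← hq n, TPoly_apply, norm_toL2_sq]; rfl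
    rw [h2]
    exact pow_le_pow_left₀ (norm_nonneg _) h1 2
  · intro n
    set pn : Matrix (Fin N) (Fin N) ℂ → ℝ := (q n).1 with hpn
    have hpn_mem : pn ∈ polySpace N n := (q n).2
    have hpc : ContDiff ℝ ∞ pn := contDiff_of_mem_polySpace hpn_mem
    set Lq : Lp ℝ 2 (haarSU N) := TPoly n ⟨Lap pn, Lap_mem_polySpace hpn_mem⟩ with hLq
    have hLq_mem : Lq ∈ VPoly N n := ⟨_, rfl⟩
    have h1 : ⟪w - wn n, Lq⟫_ℝ = 0 := Submodule.starProjection_inner_eq_zero w Lq hLq_mem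
    have h2 : ⟪wn n, Lq⟫_ℝ = -∫ g : SUN N, Gam pn pn g ∂(haarSU N) := by
      rw [← hq n, TPoly_apply, hLq, TPoly_apply, inner_toL2_toL2]
      exact integral_mul_Lap hN hpc hpc
    have h3 : ⟪w, Lq⟫_ℝ = ∫ g : SUN N, w g * Lap pn g ∂(haarSU N) := by
      rw [real_inner_comm, hLq, TPoly_apply, inner_toL2_left]
      refine integral_congr_ae (ae_of_all _ fun g => ?_)
      simp only [resPoly_apply]
      ring
    have h4 : ⟪w, Lq⟫_ℝ = ⟪wn n, Lq⟫_ℝ := by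
      have : w = (w - wn n) + wn n := by abel
      rw [this, inner_add_left, h1, zero_add]
    have h5 := hw n pn hpn_mem
    have hWc : Continuous fun g : SUN N => schWOf S g * pn g :=
      (continuous_restrict (contDiff_schWOf hS)).mul (continuous_restrict hpc)
    have i1 : Integrable (fun g : SUN N => w g * Lap pn g) (haarSU N) := by
      have := integrable_continuous_mul_L2 (continuous_restrict (contDiff_Lap hpc)) w
      exact this.congr (ae_of_all _ fun g => mul_comm _ _)
    have i2 : Integrable (fun g : SUN N => w g * (schWOf S g * pn g)) (haarSU N) := by
      have := integrable_continuous_mul_L2 hWc w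
      exact this.congr (ae_of_all _ fun g => mul_comm _ _)
    have h6 : ∫ g : SUN N, w g * Lap pn g ∂(haarSU N) = ∫ g : SUN N, w g * (schWOf S g * pn g) ∂(haarSU N) := by
      have : ∫ g : SUN N, w g * (Lap pn g - schWOf S g * pn g) ∂(haarSU N) =
          ∫ g : SUN N, w g * Lap pn g ∂(haarSU N) - ∫ g : SUN N, w g * (schWOf S g * pn g) ∂(haarSU N) := by
        rw [← integral_sub i1 i2]
        exact integral_congr_ae (ae_of_all _ fun g => by ring)
      rw [this] at h5
      linarith
    linarith [h2, h3, h4, h6]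

/-! ### From THM(IV) to the Poincaré inequality -/

/-- `p ↦ (Δ − W_S)p|_{SU(N)}` as a linear map `𝒫_n → C(SU(N), ℝ)`. [folklore] -/
private def gsCMOf {S : Matrix (Fin N) (Fin N) ℂ → ℝ} (hS : ContDiff ℝ ∞ S) (n : ℕ) :
    polySpace N n →ₗ[ℝ] C(SUN N, ℝ) where
  toFun p := resCM (fun Q => Lap p.1 Q - schWOf S Q * p.1 Q)
    (continuous_restrict ((contDiff_Lap (contDiff_of_mem_polySpace p.2)).sub
      ((contDiff_schWOf hS).mul (contDiff_of_mem_polySpace p.2))))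
  map_add' p q := by
    ext g
    simp only [resCM, ContinuousMap.coe_mk, ContinuousMap.add_apply, Submodule.coe_add]
    rw [Lap_add (contDiff_of_mem_polySpace p.2) (contDiff_of_mem_polySpace q.2)]
    simp only [Pi.add_apply]
    ring
  map_smul' r p := by
    ext g
    simp only [resCM, ContinuousMap.coe_mk, ContinuousMap.smul_apply, Submodule.coe_smul, RingHom.id_apply,
      smul_eq_mul]
    rw [Lap_smul r (contDiff_of_mem_polySpace p.2)]
    simp only [Pi.smul_apply, smul_eq_mul]
    ring

/-- Evaluation of `gsCMOf`. [folklore] -/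
@[simp] private theorem gsCMOf_apply {S : Matrix (Fin N) (Fin N) ℂ → ℝ} (hS : ContDiff ℝ ∞ S) {n : ℕ}
    (p : polySpace N n) (g : SUN N) :
    gsCMOf hS n p g = Lap p.1 g - schWOf S g * p.1 g := rfl

/-- `p ↦ (Δ − W_S)p` into `L²(σ)`. [folklore] -/
private def AnPolyOf {S : Matrix (Fin N) (Fin N) ℂ → ℝ} (hS : ContDiff ℝ ∞ S) (n : ℕ) :
    polySpace N n →ₗ[ℝ] Lp ℝ 2 (haarSU N) :=
  (toL2 (N := N)).toLinearMap.comp (gsCMOf hS n)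

/-- `AnPolyOf hS n p = toL2 (gsCMOf hS n p)`. [folklore] -/
private theorem AnPolyOf_apply {S : Matrix (Fin N) (Fin N) ℂ → ℝ} (hS : ContDiff ℝ ∞ S) {n : ℕ}
    (p : polySpace N n) : AnPolyOf hS n p = toL2 (gsCMOf hS n p) := rfl

/-- The ranges of `AnPolyOf` are monotone in the degree. [folklore] -/
private theorem monotone_range_AnPolyOf {S : Matrix (Fin N) (Fin N) ℂ → ℝ} (hS : ContDiff ℝ ∞ S) :
    Monotone fun n => LinearMap.range (AnPolyOf (N := N) hS n) := by
  intro n n' h x hx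
  obtain ⟨p, rfl⟩ := hx
  exact ⟨⟨p.1, polySpace_mono h p.2⟩, rfl⟩

/-- **Poincaré inequality from THM(IV)** for a general smooth potential with curvature constant
`K > 0`: if every `w ∈ L²(σ)` orthogonal to all `(Δ − W_S)p` is a multiple of `e^{S/2}`, then
`K ∫ e^S (u − m)² dσ ≤ ∫ e^S Γ(u,u) dσ`, `m` the `e^S σ`-mean of `u` (duality + double orthogonal
complement, as in `poincare_of_thm4`). [cite: BakryGentilLedoux2014, Prop. 4.8.1] -/
theorem poincare_of_thm4_of_curvature (hN : N ≠ 0) {S : Matrix (Fin N) (Fin N) ℂ → ℝ}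
    (hS : ContDiff ℝ ∞ S) {K : ℝ} (hK : 0 < K)
    (hCD : ∀ u : Matrix (Fin N) (Fin N) ℂ → ℝ, ContDiff ℝ ∞ u → ∀ g : SUN N,
      K * Gam u u (g : Matrix (Fin N) (Fin N) ℂ) ≤ Gam2 S u (g : Matrix (Fin N) (Fin N) ℂ))
    (hthm : ∀ w : Lp ℝ 2 (haarSU N), (∀ n, ∀ p ∈ polySpace N n,
      ∫ g : SUN N, w g * (Lap p g - schWOf S g * p g) ∂(haarSU N) = 0) →
      ∃ m : ℝ, (fun g => w g) =ᵐ[haarSU N] fun g => m * Real.exp (S g / 2))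
    {u : Matrix (Fin N) (Fin N) ℂ → ℝ} (hu : ContDiff ℝ ∞ u) :
    K * ∫ g : SUN N, Real.exp (S g) * (u g -
          (∫ g : SUN N, Real.exp (S g) * u g ∂(haarSU N)) / (∫ g : SUN N, Real.exp (S g) ∂(haarSU N))) ^ 2
          ∂(haarSU N) ≤
      ∫ g : SUN N, Real.exp (S g) * Gam u u g ∂(haarSU N) := by
  have hSc : Continuous fun g : SUN N => S g := continuous_restrict hS
  have hwc : Continuous fun g : SUN N => Real.exp (S g) := Real.continuous_exp.comp hSc
  set Z : ℝ := ∫ g : SUN N, Real.exp (S g) ∂(haarSU N) with hZ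
  have hZpos : 0 < Z := integral_exp_pos (integrable_of_continuous_SUN hwc _)
  set m : ℝ := (∫ g : SUN N, Real.exp (S g) * u g ∂(haarSU N)) / Z with hmdef
  have huc : Continuous fun g : SUN N => u g := continuous_restrict hu
  have hm0 : ∫ g : SUN N, Real.exp (S g) * (u g - m) ∂(haarSU N) = 0 := by
    have i1 : Integrable (fun g : SUN N => Real.exp (S g) * u g) (haarSU N) := integrable_of_continuous_SUN (hwc.mul huc) _
    have i2 : Integrable (fun g : SUN N => Real.exp (S g) * m) (haarSU N) := integrable_of_continuous_SUN (hwc.mul continuous_const) _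
    have : ∫ g : SUN N, Real.exp (S g) * (u g - m) ∂(haarSU N) =
        ∫ g : SUN N, Real.exp (S g) * u g ∂(haarSU N) - ∫ g : SUN N, Real.exp (S g) * m ∂(haarSU N) := by
      rw [← integral_sub i1 i2]; exact integral_congr_ae (ae_of_all _ fun g => by ring)
    rw [this, integral_mul_const, hmdef, ← hZ]
    field_simp
    ring
  have hyc : Continuous fun g : SUN N => Real.exp (S g / 2) * (u g - m) :=
    (Real.continuous_exp.comp (hSc.div_const 2)).mul (huc.sub continuous_const)
  set y : Lp ℝ 2 (haarSU N) := toL2 (resCM (fun Q => Real.exp (S Q / 2) * (u Q - m)) hyc) with hydef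
  set R : Submodule ℝ (Lp ℝ 2 (haarSU N)) := ⨆ n, LinearMap.range (AnPolyOf (N := N) hS n) with hRdef
  have hyRR : y ∈ Rᗮᗮ := by
    rw [Submodule.mem_orthogonal]
    intro z hz
    have hz' : ∀ n, ∀ p ∈ polySpace N n,
        ∫ g : SUN N, z g * (Lap p g - schWOf S g * p g) ∂(haarSU N) = 0 := by
      intro n p hp
      have hmem : AnPolyOf hS n ⟨p, hp⟩ ∈ R :=
        (le_iSup (fun n => LinearMap.range (AnPolyOf (N := N) hS n)) n) ⟨_, rfl⟩
      have h0 : ⟪AnPolyOf hS n ⟨p, hp⟩, z⟫_ℝ = 0 := (Submodule.mem_orthogonal R z).1 hz _ hmem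
      rw [AnPolyOf_apply, inner_toL2_left] at h0
      rw [← h0]
      refine integral_congr_ae (ae_of_all _ fun g => ?_)
      simp only [gsCMOf_apply]
      ring
    obtain ⟨mz, hmz⟩ := hthm z hz'
    rw [real_inner_comm, hydef, inner_toL2_left]
    have : ∫ g : SUN N, (resCM (fun Q => Real.exp (S Q / 2) * (u Q - m)) hyc) g * z g ∂(haarSU N) =
        ∫ g : SUN N, mz * (Real.exp (S g) * (u g - m)) ∂(haarSU N) := by
      refine integral_congr_ae ?_
      filter_upwards [hmz] with g hg
      rw [hg]
      simp only [resCM, ContinuousMap.coe_mk]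
      rw [← exp_half_mul_exp_half (S g)]
      ring
    rw [this, integral_const_mul, hm0, mul_zero]
  have hyclos : y ∈ R.topologicalClosure := by
    rw [← Submodule.orthogonal_orthogonal_eq_closure]; exact hyRR
  have hyclos' : y ∈ closure (R : Set (Lp ℝ 2 (haarSU N))) := by
    rw [← Submodule.topologicalClosure_coe]; exact hyclos
  obtain ⟨r, hrR, hrlim⟩ := mem_closure_iff_seq_limit.1 hyclos'
  have hdir : Directed (· ≤ ·) fun n => LinearMap.range (AnPolyOf (N := N) hS n) :=
    (monotone_range_AnPolyOf hS).directed_le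
  have hex : ∀ k, ∃ (n : ℕ) (p : polySpace N n), AnPolyOf hS n p = r k := fun k => by
    obtain ⟨n, hn⟩ := (Submodule.mem_iSup_of_directed _ hdir).1 (hrR k)
    obtain ⟨p, hp⟩ := LinearMap.mem_range.1 hn
    exact ⟨n, p, hp⟩
  choose nk pk hpk using hex
  set v : ℕ → Matrix (Fin N) (Fin N) ℂ → ℝ := fun k Q => Real.exp (-S Q / 2) * (pk k).1 Q with hvdef
  have hv : ∀ k, ContDiff ℝ ∞ (v k) := fun k => contDiff_groundState hS (contDiff_of_mem_polySpace (pk k).2)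
  have hconv : Tendsto (fun k => ∫ g : SUN N, Real.exp (S g) * (genL S (v k) g - (u g - m)) ^ 2 ∂(haarSU N))
      atTop (𝓝 0) := by
    have h1 : Tendsto (fun k => ‖r k - y‖ ^ 2) atTop (𝓝 0) := by
      have := tendsto_iff_norm_sub_tendsto_zero.1 hrlim
      simpa using this.pow 2
    refine h1.congr fun k => ?_
    rw [← hpk k, AnPolyOf_apply, hydef, norm_toL2_sub_toL2_sq]
    refine integral_congr_ae (ae_of_all _ fun g => ?_)
    simp only [gsCMOf_apply, resCM, ContinuousMap.coe_mk, hvdef]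
    rw [genL_groundState hS (contDiff_of_mem_polySpace (pk k).2)]
    have e1 := exp_half_mul_exp_half (S g)
    have e2 := exp_half_mul_exp_neg_half (S g)
    have hW : schWOf S g = (1 / 4) * Gam S S g + (1 / 2) * Lap S g := rfl
    rw [hW]
    linear_combination ((Real.exp (-S g / 2) * (Lap (pk k).1 g - ((1 / 4) * Gam S S g + (1 / 2) * Lap S g) *
      (pk k).1 g) - (u g - m)) ^ 2) * e1 +
      (-((Lap (pk k).1 g - ((1 / 4) * Gam S S g + (1 / 2) * Lap S g) * (pk k).1 g) *
        ((Lap (pk k).1 g - ((1 / 4) * Gam S S g + (1 / 2) * Lap S g) * (pk k).1 g) *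
          (1 + Real.exp (S g / 2) * Real.exp (-S g / 2)) - 2 * Real.exp (S g / 2) * (u g - m)))) * e2
  exact poincare_of_approx_of_curvature hN hS hK hCD hu m v hv hconv

/-! ### THM(IV) for the tilted measure with a general smooth potential -/

/-- **THM(IV)_S** for a general smooth potential: if `w ∈ L²(σ)` is orthogonal to `(Δ − W_S)p` for all
polynomials `p` (`W_S = ¼Γ(S,S) + ½ΔS`), then `w = m e^{S/2}` a.e. (project onto polynomials, transform
by `e^{-S/2}`, use the Poincaré inequality of the Haar measure; verbatim the argument of
`ae_eq_groundState_of_orthogonal`). [folklore] -/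
private theorem ae_eq_groundState_of_orthogonal_schWOf (hN : N ≠ 0) {S : Matrix (Fin N) (Fin N) ℂ → ℝ}
    (hS : ContDiff ℝ ∞ S) (w : Lp ℝ 2 (haarSU N))
    (hw : ∀ n, ∀ p ∈ polySpace N n,
      ∫ g : SUN N, w g * (Lap p g - schWOf S g * p g) ∂(haarSU N) = 0) :
    ∃ m : ℝ, (fun g => w g) =ᵐ[haarSU N] fun g => m * Real.exp (S g / 2) := by
  have hSc : Continuous fun g : SUN N => S g := continuous_restrict hS
  obtain ⟨p, hp, hconv, hbd, hid⟩ := exists_proj_seq_schWOf hN hS w hw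
  have hpc : ∀ n, ContDiff ℝ ∞ (p n) := fun n => contDiff_of_mem_polySpace (hp n)
  obtain ⟨CS, hCS⟩ : ∃ C, ∀ g : SUN N, Real.exp (-S g) ≤ C := by
    obtain ⟨C, hC⟩ := (isCompact_univ (X := SUN N)).exists_bound_of_continuousOn
      ((Real.continuous_exp.comp hSc.neg).continuousOn)
    exact ⟨C, fun g => (Real.le_norm_self _).trans (hC g (Set.mem_univ _))⟩
  have hCS0 : 0 ≤ CS := (Real.exp_pos _).le.trans (hCS 1)
  obtain ⟨CW, hCW⟩ : ∃ C, ∀ g : SUN N, |schWOf S g| ≤ C := by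
    obtain ⟨C, hC⟩ := (isCompact_univ (X := SUN N)).exists_bound_of_continuousOn
      ((continuous_restrict (contDiff_schWOf hS)).continuousOn)
    exact ⟨C, fun g => (hC g (Set.mem_univ _))⟩
  have hCW0 : 0 ≤ CW := (abs_nonneg _).trans (hCW 1)
  set q : ℕ → Matrix (Fin N) (Fin N) ℂ → ℝ := fun n Q => Real.exp (-S Q / 2) * p n Q with hqdef
  have hq : ∀ n, ContDiff ℝ ∞ (q n) := fun n => contDiff_groundState hS (hpc n)
  -- (d) the ground-state identity, integrated
  have hd : ∀ n, ∫ g : SUN N, Real.exp (S g) * Gam (q n) (q n) g ∂(haarSU N) =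
      ∫ g : SUN N, Gam (p n) (p n) g ∂(haarSU N) + ∫ g : SUN N, schWOf S g * p n g ^ 2 ∂(haarSU N) := by
    intro n
    have hpn := hpc n
    have h1 : ∫ g : SUN N, p n g ^ 2 * Lap S g ∂(haarSU N) =
        -∫ g : SUN N, 2 * (p n g * Gam S (p n) g) ∂(haarSU N) := by
      have h := integral_mul_Lap hN (F := fun Q => p n Q * p n Q) (hpn.mul hpn) hS
      have e : ∀ g : SUN N, Gam (fun Q => p n Q * p n Q) S g = 2 * (p n g * Gam S (p n) g) := fun g => by
        show Gam (p n * p n) S g = _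
        rw [Gam_mul_left (F := p n) (G := p n) hpn hpn, Gam_comm (p n) S]; ring
      simp only [e] at h
      rw [← h]
      exact integral_congr_ae (ae_of_all _ fun g => by ring)
    have i1 : Integrable (fun g : SUN N => Gam (p n) (p n) g) (haarSU N) :=
      integrable_of_continuous_SUN (continuous_restrict (contDiff_Gam hpn hpn)) _
    have i2 : Integrable (fun g : SUN N => p n g * Gam S (p n) g) (haarSU N) :=
      integrable_of_continuous_SUN ((continuous_restrict hpn).mul (continuous_restrict (contDiff_Gam hS hpn))) _
    have i3 : Integrable (fun g : SUN N => 1 / 4 * p n g ^ 2 * Gam S S g) (haarSU N) :=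
      integrable_of_continuous_SUN ((continuous_const.mul ((continuous_restrict hpn).pow 2)).mul
        (continuous_restrict (contDiff_Gam hS hS))) _
    have i4 : Integrable (fun g : SUN N => p n g ^ 2 * Lap S g) (haarSU N) :=
      integrable_of_continuous_SUN (((continuous_restrict hpn).pow 2).mul (continuous_restrict (contDiff_Lap hS))) _
    have i12 : Integrable (fun g : SUN N => Gam (p n) (p n) g - p n g * Gam S (p n) g) (haarSU N) := i1.sub i2
    calc ∫ g : SUN N, Real.exp (S g) * Gam (q n) (q n) g ∂(haarSU N)
        = ∫ g : SUN N, (Gam (p n) (p n) g - p n g * Gam S (p n) g + 1 / 4 * p n g ^ 2 * Gam S S g) ∂(haarSU N) :=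
          integral_congr_ae (ae_of_all _ fun g => exp_mul_Gam_groundState hS hpn _)
      _ = ∫ g : SUN N, Gam (p n) (p n) g ∂(haarSU N) - ∫ g : SUN N, p n g * Gam S (p n) g ∂(haarSU N) +
            ∫ g : SUN N, 1 / 4 * p n g ^ 2 * Gam S S g ∂(haarSU N) := by
          rw [integral_add i12 i3, integral_sub i1 i2]
      _ = ∫ g : SUN N, Gam (p n) (p n) g ∂(haarSU N) + ∫ g : SUN N, schWOf S g * p n g ^ 2 ∂(haarSU N) := by
          have e2 : ∫ g : SUN N, p n g * Gam S (p n) g ∂(haarSU N) =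
              -(1 / 2) * ∫ g : SUN N, p n g ^ 2 * Lap S g ∂(haarSU N) := by
            rw [h1, integral_const_mul]; ring
          have e3 : ∫ g : SUN N, schWOf S g * p n g ^ 2 ∂(haarSU N) =
              ∫ g : SUN N, 1 / 4 * p n g ^ 2 * Gam S S g ∂(haarSU N) +
                (1 / 2) * ∫ g : SUN N, p n g ^ 2 * Lap S g ∂(haarSU N) := by
            rw [← integral_const_mul, ← integral_add i3 (i4.const_mul _)]
            refine integral_congr_ae (ae_of_all _ fun g => ?_)
            simp only [schWOf]
            ring
          rw [e2, e3]; ring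
  have hT0 : ∀ n, 0 ≤ ∫ g : SUN N, Real.exp (S g) * Gam (q n) (q n) g ∂(haarSU N) := fun n =>
    integral_nonneg fun g => mul_nonneg (Real.exp_pos _).le (Gam_self_nonneg _ _)
  have hTle : ∀ n, ∫ g : SUN N, Real.exp (S g) * Gam (q n) (q n) g ∂(haarSU N) ≤
      CW * ‖w‖ * Real.sqrt (∫ g : SUN N, (p n g - w g) ^ 2 ∂(haarSU N)) := by
    intro n
    have hpn := hpc n
    set φ : C(SUN N, ℝ) := resCM (fun Q => schWOf S Q * p n Q)
      (continuous_restrict ((contDiff_schWOf hS).mul hpn)) with hφ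
    set x : Lp ℝ 2 (haarSU N) := toL2 (resPoly n ⟨p n, hp n⟩) - w with hx
    have hWp : ∫ g : SUN N, schWOf S g * p n g ^ 2 ∂(haarSU N) - ∫ g : SUN N, w g * (schWOf S g * p n g) ∂(haarSU N)
        = ∫ g : SUN N, φ g * x g ∂(haarSU N) := by
      have i1 : Integrable (fun g : SUN N => schWOf S g * p n g ^ 2) (haarSU N) :=
        integrable_of_continuous_SUN ((continuous_restrict (contDiff_schWOf hS)).mul ((continuous_restrict hpn).pow 2)) _
      have i2 : Integrable (fun g : SUN N => w g * (schWOf S g * p n g)) (haarSU N) := by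
        have := integrable_continuous_mul_L2 ((continuous_restrict (contDiff_schWOf hS)).mul (continuous_restrict hpn)) w
        exact this.congr (ae_of_all _ fun g => mul_comm _ _)
      rw [← integral_sub i1 i2]
      refine integral_congr_ae ?_
      filter_upwards [Lp.coeFn_sub (toL2 (resPoly n ⟨p n, hp n⟩)) w,
        ContinuousMap.coeFn_toLp (p := 2) (μ := haarSU N) (𝕜 := ℝ) (resPoly n ⟨p n, hp n⟩)] with g hsub hres
      rw [hx, hsub, Pi.sub_apply, hres, resPoly_apply, hφ]
      simp only [resCM, ContinuousMap.coe_mk]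
      ring
    have hcs := abs_integral_mul_L2_le φ x
    have hφbd : Real.sqrt (∫ g : SUN N, φ g ^ 2 ∂(haarSU N)) ≤ CW * ‖w‖ := by
      have h2 : ∫ g : SUN N, φ g ^ 2 ∂(haarSU N) ≤ CW ^ 2 * ∫ g : SUN N, p n g ^ 2 ∂(haarSU N) := by
        rw [← integral_const_mul]
        refine integral_mono (integrable_of_continuous_SUN (φ.continuous.pow 2) _)
          ((integrable_of_continuous_SUN ((continuous_restrict hpn).pow 2) _).const_mul _) fun g => ?_
        simp only [hφ, resCM, ContinuousMap.coe_mk, mul_pow]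
        exact mul_le_mul_of_nonneg_right (by
          rw [← sq_abs]; exact pow_le_pow_left₀ (abs_nonneg _) (hCW g) 2) (sq_nonneg _)
      calc Real.sqrt (∫ g : SUN N, φ g ^ 2 ∂(haarSU N)) ≤ Real.sqrt (CW ^ 2 * ‖w‖ ^ 2) :=
            Real.sqrt_le_sqrt (h2.trans (mul_le_mul_of_nonneg_left (hbd n) (sq_nonneg _)))
        _ = CW * ‖w‖ := by rw [Real.sqrt_mul (sq_nonneg _), Real.sqrt_sq hCW0, Real.sqrt_sq (norm_nonneg _)]
    have hxn : ‖x‖ = Real.sqrt (∫ g : SUN N, (p n g - w g) ^ 2 ∂(haarSU N)) := by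
      rw [hx, ← Real.sqrt_sq (norm_nonneg (toL2 (resPoly n ⟨p n, hp n⟩) - w)), norm_toL2_sub_sq]; rfl
    rw [hd n, hid n]
    calc -∫ g : SUN N, w g * (schWOf S g * p n g) ∂(haarSU N) + ∫ g : SUN N, schWOf S g * p n g ^ 2 ∂(haarSU N)
        = ∫ g : SUN N, φ g * x g ∂(haarSU N) := by rw [← hWp]; ring
      _ ≤ |∫ g : SUN N, φ g * x g ∂(haarSU N)| := le_abs_self _
      _ ≤ Real.sqrt (∫ g : SUN N, φ g ^ 2 ∂(haarSU N)) * ‖x‖ := hcs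
      _ ≤ CW * ‖w‖ * Real.sqrt (∫ g : SUN N, (p n g - w g) ^ 2 ∂(haarSU N)) := by
          rw [hxn]; exact mul_le_mul_of_nonneg_right hφbd (Real.sqrt_nonneg _)
  have hTlim : Tendsto (fun n => ∫ g : SUN N, Real.exp (S g) * Gam (q n) (q n) g ∂(haarSU N)) atTop (𝓝 0) := by
    have hup : Tendsto (fun n => CW * ‖w‖ * Real.sqrt (∫ g : SUN N, (p n g - w g) ^ 2 ∂(haarSU N))) atTop (𝓝 0) := by
      have := ((Real.continuous_sqrt.tendsto 0).comp hconv).const_mul (CW * ‖w‖)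
      simpa using this
    exact tendsto_of_tendsto_of_tendsto_of_le_of_le tendsto_const_nhds hup hT0 hTle
  -- (g) Poincaré for the Haar measure applied to `q n`
  set μn : ℕ → ℝ := fun n => ∫ g : SUN N, q n g ∂(haarSU N) with hμn
  have hD : Tendsto (fun n => ∫ g : SUN N, (q n g - μn n) ^ 2 ∂(haarSU N)) atTop (𝓝 0) := by
    have hN2 : 0 < (N : ℝ) / 2 := div_pos (Nat.cast_pos.2 (Nat.pos_of_ne_zero hN)) two_pos
    have hle : ∀ n, ∫ g : SUN N, (q n g - μn n) ^ 2 ∂(haarSU N) ≤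
        (2 / N * CS) * ∫ g : SUN N, Real.exp (S g) * Gam (q n) (q n) g ∂(haarSU N) := by
      intro n
      have h1 := poincare_haar hN (hq n)
      have h2 : ∫ g : SUN N, Gam (q n) (q n) g ∂(haarSU N) ≤
          CS * ∫ g : SUN N, Real.exp (S g) * Gam (q n) (q n) g ∂(haarSU N) := by
        rw [← integral_const_mul]
        refine integral_mono (integrable_of_continuous_SUN (continuous_restrict (contDiff_Gam (hq n) (hq n))) _)
          ((integrable_of_continuous_SUN ((Real.continuous_exp.comp hSc).mul
            (continuous_restrict (contDiff_Gam (hq n) (hq n)))) _).const_mul _) fun g => ?_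
        have hΓ := Gam_self_nonneg (q n) (g : Matrix (Fin N) (Fin N) ℂ)
        calc Gam (q n) (q n) g = Real.exp (-S g) * (Real.exp (S g) * Gam (q n) (q n) g) := by
              rw [← mul_assoc, ← Real.exp_add, show -S g + S g = 0 by ring, Real.exp_zero, one_mul]
          _ ≤ CS * (Real.exp (S g) * Gam (q n) (q n) g) :=
              mul_le_mul_of_nonneg_right (hCS g) (mul_nonneg (Real.exp_pos _).le hΓ)
      calc ∫ g : SUN N, (q n g - μn n) ^ 2 ∂(haarSU N)
          = (2 / N) * ((N : ℝ) / 2 * ∫ g : SUN N, (q n g - μn n) ^ 2 ∂(haarSU N)) := by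
            field_simp
        _ ≤ (2 / N) * (CS * ∫ g : SUN N, Real.exp (S g) * Gam (q n) (q n) g ∂(haarSU N)) :=
            mul_le_mul_of_nonneg_left (h1.trans h2) (by positivity)
        _ = (2 / N * CS) * ∫ g : SUN N, Real.exp (S g) * Gam (q n) (q n) g ∂(haarSU N) := by ring
    have hup : Tendsto (fun n => (2 / N * CS) * ∫ g : SUN N, Real.exp (S g) * Gam (q n) (q n) g ∂(haarSU N))
        atTop (𝓝 0) := by simpa using hTlim.const_mul (2 / N * CS)
    exact tendsto_of_tendsto_of_tendsto_of_le_of_le tendsto_const_nhds hup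
      (fun n => integral_nonneg fun g => sq_nonneg _) hle
  -- (h) `q n → e^{-S/2} w` in `L²(σ)`
  set qf : SUN N → ℝ := fun g => Real.exp (-S g / 2) * w g with hqf
  have hqf_mem : MemLp qf 2 (haarSU N) := by
    have hb : MemLp (fun g : SUN N => Real.exp (-S g / 2)) (⊤ : ENNReal) (haarSU N) := by
      have hc : Continuous fun g : SUN N => Real.exp (-S g / 2) := Real.continuous_exp.comp (hSc.neg.div_const 2)
      obtain ⟨C, hC⟩ := (isCompact_univ (X := SUN N)).exists_bound_of_continuousOn hc.continuousOn
      exact memLp_top_of_bound hc.aestronglyMeasurable C (ae_of_all _ fun g => hC g (Set.mem_univ _))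
    exact MemLp.mul' (Lp.memLp w) hb
  set Qf : Lp ℝ 2 (haarSU N) := hqf_mem.toLp qf with hQf
  have hQf_coe : (fun g => Qf g) =ᵐ[haarSU N] qf := hqf_mem.coeFn_toLp
  have hQn : Tendsto (fun n => ‖toL2 (resCM (q n) (continuous_restrict (hq n))) - Qf‖ ^ 2) atTop (𝓝 0) := by
    have hle : ∀ n, ‖toL2 (resCM (q n) (continuous_restrict (hq n))) - Qf‖ ^ 2 ≤
        CS * ∫ g : SUN N, (p n g - w g) ^ 2 ∂(haarSU N) := by
      intro n
      rw [norm_sq_eq_integral, ← integral_const_mul]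
      refine integral_mono_ae (integrable_sq_L2 _) ((((integrable_sq_L2 (toL2 (resPoly n ⟨p n, hp n⟩) - w)).const_mul CS)).congr ?_) ?_
      · filter_upwards [Lp.coeFn_sub (toL2 (resPoly n ⟨p n, hp n⟩)) w,
          ContinuousMap.coeFn_toLp (p := 2) (μ := haarSU N) (𝕜 := ℝ) (resPoly n ⟨p n, hp n⟩)] with g hsub hres
        rw [hsub, Pi.sub_apply, hres, resPoly_apply]
      · filter_upwards [Lp.coeFn_sub (toL2 (resCM (q n) (continuous_restrict (hq n)))) Qf, hQf_coe,
          ContinuousMap.coeFn_toLp (p := 2) (μ := haarSU N) (𝕜 := ℝ) (resCM (q n) (continuous_restrict (hq n)))]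
          with g hsub hQ hres
        rw [hsub, Pi.sub_apply, hQ, hres]
        simp only [resCM, ContinuousMap.coe_mk, hqdef, hqf]
        rw [← mul_sub, mul_pow]
        refine mul_le_mul_of_nonneg_right ?_ (sq_nonneg _)
        rw [← Real.exp_nat_mul]; norm_num
        rw [show (2 : ℝ) * (-S g / 2) = -S g by ring]
        exact hCS g
    have hup : Tendsto (fun n => CS * ∫ g : SUN N, (p n g - w g) ^ 2 ∂(haarSU N)) atTop (𝓝 0) := by
      simpa using hconv.const_mul CS
    exact tendsto_of_tendsto_of_tendsto_of_le_of_le tendsto_const_nhds hup (fun n => sq_nonneg _) hle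
  -- (i) the constants `μ n` converge to `Qf` in `L²`
  have hCn : Tendsto (fun n => cL (μn n)) atTop (𝓝 Qf) := by
    rw [tendsto_iff_norm_sub_tendsto_zero]
    have h1 : ∀ n, ‖cL (μn n) - Qf‖ ≤ Real.sqrt (∫ g : SUN N, (q n g - μn n) ^ 2 ∂(haarSU N)) +
        Real.sqrt (‖toL2 (resCM (q n) (continuous_restrict (hq n))) - Qf‖ ^ 2) := by
      intro n
      have e1 : Real.sqrt (∫ g : SUN N, (q n g - μn n) ^ 2 ∂(haarSU N)) =
          ‖toL2 (resCM (q n) (continuous_restrict (hq n))) - cL (μn n)‖ := by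
        rw [← Real.sqrt_sq (norm_nonneg (toL2 (resCM (q n) (continuous_restrict (hq n))) - cL (μn n))),
          norm_toL2_sub_cL_sq]; rfl
      rw [e1, Real.sqrt_sq (norm_nonneg _), ← norm_neg (toL2 _ - cL (μn n)), neg_sub]
      exact norm_sub_le_norm_sub_add_norm_sub _ _ _
    have h2 : Tendsto (fun n => Real.sqrt (∫ g : SUN N, (q n g - μn n) ^ 2 ∂(haarSU N)) +
        Real.sqrt (‖toL2 (resCM (q n) (continuous_restrict (hq n))) - Qf‖ ^ 2)) atTop (𝓝 0) := by
      have := ((Real.continuous_sqrt.tendsto 0).comp hD).add ((Real.continuous_sqrt.tendsto 0).comp hQn)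
      simpa using this
    exact tendsto_of_tendsto_of_tendsto_of_le_of_le tendsto_const_nhds h2 (fun n => norm_nonneg _) h1
  obtain ⟨m, hm⟩ := ae_eq_const_of_tendsto_cL Qf μn hCn
  refine ⟨m, ?_⟩
  filter_upwards [hm, hQf_coe] with g h1 h2
  have h3 : qf g = m := by rw [← h2]; exact h1
  simp only [hqf] at h3
  calc w g = Real.exp (S g / 2) * (Real.exp (-S g / 2) * w g) := by
        rw [← mul_assoc, exp_half_mul_exp_neg_half, one_mul]
    _ = m * Real.exp (S g / 2) := by rw [h3, mul_comm]

/-- **The Bakry–Émery Poincaré inequality on `SU(N)` under a curvature bound** (Bakry–Émery 1985;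
Bakry–Gentil–Ledoux Prop. 4.8.1, `CD(K,∞) ⇒ Poincaré(1/K)`; Shen–Zhu–Zhu Thm. 4.2 / Cor. 4.4 for one
link is the case `S = N Re tr(· B)`): for `N ≠ 0`, a smooth potential `S` on `M_N(ℂ)` and `K > 0` with
`K Γ(u,u)(g) ≤ Γ₂^S(u)(g)` for all smooth `u` and all `g ∈ SU(N)`, every smooth `u` satisfies
`K ∫ e^S (u − m)² dσ ≤ ∫ e^S Γ(u,u) dσ`, where `m = (∫ e^S u dσ)/(∫ e^S dσ)`. [cite: BakryGentilLedoux2014, Prop. 4.8.1] -/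
theorem poincare_of_curvature (hN : N ≠ 0) {S : Matrix (Fin N) (Fin N) ℂ → ℝ}
    (hS : ContDiff ℝ ∞ S) {K : ℝ} (hK : 0 < K)
    (hCD : ∀ u : Matrix (Fin N) (Fin N) ℂ → ℝ, ContDiff ℝ ∞ u → ∀ g : SUN N,
      K * Gam u u (g : Matrix (Fin N) (Fin N) ℂ) ≤ Gam2 S u (g : Matrix (Fin N) (Fin N) ℂ))
    {u : Matrix (Fin N) (Fin N) ℂ → ℝ} (hu : ContDiff ℝ ∞ u) :
    K * ∫ g : SUN N, Real.exp (S g) * (u g -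
          (∫ g : SUN N, Real.exp (S g) * u g ∂(haarSU N)) / (∫ g : SUN N, Real.exp (S g) ∂(haarSU N))) ^ 2
          ∂(haarSU N) ≤
      ∫ g : SUN N, Real.exp (S g) * Gam u u g ∂(haarSU N) :=
  poincare_of_thm4_of_curvature hN hS hK hCD (fun w hw => ae_eq_groundState_of_orthogonal_schWOf hN hS w hw) hu

/-- The linear potential of `SUNBakryEmeryPoincare.lean` is the special case: its curvature bound
`Gam2_potential_ge` feeds `poincare_of_curvature` and returns `poincare_pot`. [cite: arXiv220412737, Cor. 4.4 (4.11) (p. 19)] -/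
theorem poincare_pot_of_curvature (hN : N ≠ 0) (c : ℝ) (B : Matrix (Fin N) (Fin N) ℂ)
    (hK : 0 < (N : ℝ) / 2 - |c| * matrixOpNorm B) {u : Matrix (Fin N) (Fin N) ℂ → ℝ} (hu : ContDiff ℝ ∞ u) :
    ((N : ℝ) / 2 - |c| * matrixOpNorm B) *
        ∫ g : SUN N, Real.exp (pot c B g) * (u g -
          (∫ g : SUN N, Real.exp (pot c B g) * u g ∂(haarSU N)) / (∫ g : SUN N, Real.exp (pot c B g) ∂(haarSU N))) ^ 2
          ∂(haarSU N) ≤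
      ∫ g : SUN N, Real.exp (pot c B g) * Gam u u g ∂(haarSU N) :=
  poincare_of_curvature hN (contDiff_pot c B) hK
    (fun _ hu g => Gam2_potential_ge hN c B hu (SUN.mem_unitaryGroup g)) hu

end SUNBakryEmery

end Literature.MathematicalPhysics.QuantumFieldTheory

end
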